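import Mathlib
import Literature.NumberTheory.Transcendental.LindemannWeierstrassProofs
import Literature.NumberTheory.Transcendental.SchanuelEclEmptyProofs
import Literature.Barriers.Schanuel.AlgebraicIndependenceOfLogarithms
import Literature.Barriers.Schanuel.NesterenkoModularScope
import Summits.Schanuel.Schanuel.Theses.RigidCore
import Summits.Schanuel.Schanuel.Theses.ToricPeriods
import Summits.Schanuel.Schanuel.Theorems.AclSubsetLogFreeCore.Negative.LogFreeCoreObjects
import Summits.Schanuel.Schanuel.Theorems.RigidCoreSchanuelOnLogFreeCoreCalibrationA
import Summits.Schanuel.Schanuel.Theorems.RigidCoreSchanuelOnLogFreeCoreCalibrationB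

/-!
# Calibration of the crux `RigidCore.SchanuelOnLogFreeCore` against the Baker side: `(R) ⟹ π ⊥ log 2`

Crux `stmt-Schanuel-0970` (`Summit.Schanuel.Schanuel.Theses.RigidCore.SchanuelOnLogFreeCore`, (R):
Schanuel's conjecture for `ℚ`-linearly independent tuples drawn from the LOG-FREE CORE
`C_EA = logFreeCore = sInf {K ≤ ℂ | 2πi ∈ K, K exp-closed, K relatively algebraically closed}`),
line `generic-period-fibre`, registered stub S2 `stub_calibR_piLogTwo`.  This file CALIBRATES the
crux itself and credits nothing towards it: it records, kernel-checked, that (R) already contains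
the algebraic independence of `π` and `log 2`,

* `CalibrationR.piLogTwo_of_schanuelOnLogFreeCore` = **`stub_calibR_piLogTwo`** (registered stub,
  signature verbatim): `(R) ⟹ AlgebraicIndependent ℚ ![Real.pi, Real.log 2]`;
* `CalibrationR.piLogTwoAlgIndep_of_schanuelOnLogFreeCore`: the same conclusion under its route
  name `Summit.Schanuel.Schanuel.Theses.ToricPeriods.PiLogTwoAlgIndep` (definitionally equal).

The conclusion is printed OPEN: "it is not even known whether or not there exist two elements of
`L` [logarithms of algebraic numbers] which are algebraically independent over `ℚ`" (D. Roy,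
*Matrices whose coefficients are linear forms in logarithms*, J. Number Theory 41 (1992),
Introduction p. 22; M. Waldschmidt, *Diophantine Approximation on Linear Algebraic Groups*,
Springer (2000), §1.4).  So the crux's docstring remark that (R) "excludes log 2 ⊥ π" is wrong in
substance: a refutation of `PiLogTwoAlgIndep` would refute (R).

PROOF (dichotomy on `log 2 ∈ C_EA`, no hull lemma; modelled on
`CalibrationA.expOnePi_of_schanuelOnKernelFreeCore`).  `C_EA` contains `2πi`, `i` and `2` (algebraic
numbers lie in every relatively algebraically closed `K`), hence `π` and `πi`.
* If `log 2 ∈ C_EA`: (R) at the `ℚ`-linearly independent pair `(πi, log 2) ⊂ C_EA`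
  (`Literature.Barriers.Schanuel.linearIndependent_piI_log_two`) gives
  `2 ≤ trdeg ℚ(πi, log 2, e^{πi} = −1, e^{log 2} = 2) ≤ trdeg ℚ(π, log 2, i) = trdeg ℚ(π, log 2)`.
* If `log 2 ∉ C_EA`: `C_EA` is relatively algebraically closed and contains `π`, so `log 2` is
  transcendental over `ℚ(π) ≤ C_EA`, while `π` is transcendental (Lindemann, tree fact
  `Literature.NumberTheory.Transcendental.transcendental_pi_holds`, PROVED); the tower law
  (`add_le_trdeg_adjoin_union`) gives `1 + 1 ≤ trdeg ℚ(π, log 2)`.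
Either way `![π, log 2]` is algebraically independent in `ℂ`
(`algebraicIndependent_of_le_trdeg_adjoin`), hence in `ℝ` (`algebraicIndependent_real_of_complex`).

What is NOT claimed: neither (R) nor `π ⊥ log 2` is proved; this is an implication between two
open statements.  All auxiliary results live in the sub-namespace
`Summit.Schanuel.Schanuel.Theorems.RigidCore.CalibrationR`; only the registered stub
`stub_calibR_piLogTwo` is declared directly in `Summit.Schanuel.Schanuel.Theorems.RigidCore`.

Sources: Lindemann 1882 (A. Baker, *Transcendental Number Theory* (1975), Ch. 1 Thm 1.3) through
`transcendental_pi_holds`; Roy 1992 p. 22 and Waldschmidt 2000 §1.4 for the open status of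
`π ⊥ log 2`; the field-theoretic glue (`algebraicIndependent_of_le_trdeg_adjoin`,
`algebraicIndependent_real_of_complex`, `trdeg_adjoin_union_eq_of_isAlgebraic`,
`add_le_trdeg_adjoin_union`, `linearIndependent_piI_log_two`) is the tree's
(`Literature.Barriers.Schanuel.*`, `Literature.NumberTheory.Transcendental.*`), and the objects
`logFreeCore`, `coreFamily`, `kernelFreeCore` with their API are the tree's
(`…AclSubsetLogFreeCore.Negative.LogFreeCoreObjects`, `RigidCoreDefs`, `CalibrationA/B`).
-/

noncomputable section

namespace Summit.Schanuel.Schanuel.Theorems.RigidCore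

open Complex IntermediateField
open Literature.NumberTheory.Transcendental
open Summit.Schanuel.Schanuel.Theorems.AclSubsetLogFreeCore.Negative

namespace CalibrationR

/-! ## The crux with its `sInf` named, and the elements `i, 2, π, πi` of the log-free core -/

/-- The crux (R) is literally Schanuel's statement for `ℚ`-linearly independent tuples from
`logFreeCore` (the crux's `sInf` is `logFreeCore = sInf coreFamily` verbatim). -/
theorem schanuelOnLogFreeCore_iff :
    Summit.Schanuel.Schanuel.Theses.RigidCore.SchanuelOnLogFreeCore ↔
      ∀ (n : ℕ) (x : Fin n → ℂ), (∀ i, x i ∈ logFreeCore) → LinearIndependent ℚ x →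
        (n : Cardinal) ≤ Algebra.trdeg ℚ
          ↥(IntermediateField.adjoin ℚ (Set.range x ∪ Set.range (Complex.exp ∘ x))) :=
  Iff.rfl

/-- `i ∈ C_EA` (`i` is algebraic, so it lies in the kernel-free core `M ≤ C_EA`). -/
theorem I_mem_logFreeCore : I ∈ logFreeCore :=
  CalibrationB.kernelFreeCore_le_logFreeCore CalibrationB.I_mem_kernelFreeCore

/-- `2 ∈ C_EA`. -/
theorem two_mem_logFreeCore : (2 : ℂ) ∈ logFreeCore :=
  CalibrationB.kernelFreeCore_le_logFreeCore CalibrationB.two_mem_kernelFreeCore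

/-- `π ∈ C_EA`: `π = 2πi / (2i)` with `2πi, 2, i ∈ C_EA`. -/
theorem pi_mem_logFreeCore : (Real.pi : ℂ) ∈ logFreeCore := by
  have hπ : (Real.pi : ℂ) = 2 * ↑Real.pi * I / (2 * I) := by
    field_simp [Complex.I_ne_zero]
  rw [hπ]
  exact div_mem two_pi_I_mem_logFreeCore (mul_mem two_mem_logFreeCore I_mem_logFreeCore)

/-- `πi ∈ C_EA`. -/
theorem pi_mul_I_mem_logFreeCore : (Real.pi : ℂ) * I ∈ logFreeCore :=
  mul_mem pi_mem_logFreeCore I_mem_logFreeCore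

/-- `π` is transcendental as a complex number (Lindemann, tree fact `transcendental_pi_holds`,
transported along the injective `algebraMap ℝ ℂ`). -/
theorem transcendental_pi_complex : Transcendental ℚ (Real.pi : ℂ) := fun h =>
  transcendental_pi_holds ((isAlgebraic_algebraMap_iff (A := ℂ) Complex.ofReal_injective).mp h)

/-! ## `(R) ⟹ π ⊥ log 2` -/

/-- **(R) implies `π ⊥ log 2`.**  Dichotomy on `log 2 ∈ C_EA`: if `log 2 ∈ C_EA`, (R) at the
`ℚ`-linearly independent pair `(πi, log 2) ⊂ C_EA` gives
`2 ≤ trdeg ℚ(πi, log 2, e^{πi} = −1, e^{log 2} = 2) ≤ trdeg ℚ(π, log 2, i) = trdeg ℚ(π, log 2)`;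
if `log 2 ∉ C_EA`, then `log 2` is transcendental over the relatively algebraically closed field
`C_EA ∋ π`, hence over `ℚ(π)`, and `π` is transcendental (Lindemann), so `trdeg ℚ(π, log 2) ≥ 1 + 1`
by the tower law.  Either way `![π, log 2]` is algebraically independent (transfer to `ℝ` along
`Complex.ofReal`).  The hypothesis is the crux (R) BY NAME; the conclusion is printed open
(Roy 1992 p. 22, Waldschmidt 2000 §1.4). -/
theorem piLogTwo_of_schanuelOnLogFreeCore
    (hR : Summit.Schanuel.Schanuel.Theses.RigidCore.SchanuelOnLogFreeCore) :
    AlgebraicIndependent ℚ ![Real.pi, Real.log 2] := by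
  -- adapted from `CalibrationA.expOnePi_of_schanuelOnKernelFreeCore` ((e, π, M) ↦ (π, log 2, C_EA))
  have hR' := schanuelOnLogFreeCore_iff.mp hR
  set l : Fin 2 → ℂ := fun i => ((![Real.pi, Real.log 2] i : ℝ) : ℂ) with hl
  suffices h2 : ((2 : ℕ) : Cardinal) ≤ Algebra.trdeg ℚ (adjoin ℚ (Set.range l)) by
    exact Literature.Barriers.Schanuel.algebraicIndependent_real_of_complex _
      (Literature.Barriers.Schanuel.algebraicIndependent_of_le_trdeg_adjoin l h2)
  have hl0 : l 0 = (Real.pi : ℂ) := by simp [hl]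
  have hl1 : l 1 = ((Real.log 2 : ℝ) : ℂ) := by simp [hl]
  have hpi_mem : (Real.pi : ℂ) ∈ adjoin ℚ (Set.range l) := hl0 ▸ subset_adjoin ℚ _ ⟨0, rfl⟩
  have hlog_mem : ((Real.log 2 : ℝ) : ℂ) ∈ adjoin ℚ (Set.range l) :=
    hl1 ▸ subset_adjoin ℚ _ ⟨1, rfl⟩
  by_cases h2C : ((Real.log 2 : ℝ) : ℂ) ∈ logFreeCore
  · -- Case `log 2 ∈ C_EA`: (R) at `(πi, log 2)`.
    have hx : ∀ i, (![(Real.pi : ℂ) * I, ((Real.log 2 : ℝ) : ℂ)] i) ∈ logFreeCore := by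
      intro i
      fin_cases i
      · exact pi_mul_I_mem_logFreeCore
      · exact h2C
    have h2 := hR' 2 _ hx Literature.Barriers.Schanuel.linearIndependent_piI_log_two
    have hI' : I ∈ adjoin ℚ (Set.range l ∪ {I}) := subset_adjoin ℚ _ (Or.inr rfl)
    have hmono : adjoin ℚ (Set.range l) ≤ adjoin ℚ (Set.range l ∪ {I}) :=
      adjoin.mono ℚ _ _ Set.subset_union_left
    have hle : adjoin ℚ (Set.range ![(Real.pi : ℂ) * I, ((Real.log 2 : ℝ) : ℂ)] ∪
        Set.range (Complex.exp ∘ ![(Real.pi : ℂ) * I, ((Real.log 2 : ℝ) : ℂ)])) ≤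
        adjoin ℚ (Set.range l ∪ {I}) := by
      rw [adjoin_le_iff]
      rintro w (⟨i, rfl⟩ | ⟨i, rfl⟩) <;> fin_cases i
      · simpa using mul_mem (hmono hpi_mem) hI'
      · simpa using hmono hlog_mem
      · simp [Complex.exp_pi_mul_I]
      · suffices h : ((Real.log 2 : ℝ) : ℂ).exp ∈ adjoin ℚ (Set.range l ∪ {I}) by simpa using h
        rw [← Complex.ofReal_exp, Real.exp_log two_pos, Complex.ofReal_ofNat]
        exact ofNat_mem _ 2
    have hunion : Algebra.trdeg ℚ (adjoin ℚ (Set.range l ∪ {I})) =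
        Algebra.trdeg ℚ (adjoin ℚ (Set.range l)) :=
      Literature.Barriers.Schanuel.trdeg_adjoin_union_eq_of_isAlgebraic (K := ℚ) (Set.range l)
        ({I} : Set ℂ) (fun x hx => by
          rw [Set.mem_singleton_iff.mp hx]
          exact Literature.Barriers.Schanuel.isAlgebraic_I)
    exact (h2.trans (CalibrationA.trdeg_mono hle)).trans_eq hunion
  · -- Case `log 2 ∉ C_EA`: `log 2` is transcendental over `C_EA ⊇ ℚ(π)`, and `π` is transcendental.
    set F : IntermediateField ℚ ℂ := adjoin ℚ ({(Real.pi : ℂ)} : Set ℂ) with hF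
    have hFC : F ≤ logFreeCore :=
      adjoin_le_iff.mpr (Set.singleton_subset_iff.mpr pi_mem_logFreeCore)
    have ha : (1 : Cardinal) ≤ Algebra.trdeg ℚ F :=
      CalibrationA.one_le_trdeg_of_transcendental_mem (mem_adjoin_simple_self ℚ _)
        transcendental_pi_complex
    have hlogF : Transcendental F ((Real.log 2 : ℝ) : ℂ) := fun halg =>
      h2C (logFreeCore_mem_coreFamily.2.2 _ (isAlgebraic_of_le hFC halg))
    have hb : (1 : Cardinal) ≤
        Algebra.trdeg F (adjoin F ({((Real.log 2 : ℝ) : ℂ)} : Set ℂ)) :=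
      CalibrationA.one_le_trdeg_adjoin_of_transcendental F hlogF
    have h2 : (1 : Cardinal) + 1 ≤
        Algebra.trdeg ℚ (adjoin ℚ (({(Real.pi : ℂ)} : Set ℂ) ∪ {((Real.log 2 : ℝ) : ℂ)})) :=
      add_le_trdeg_adjoin_union _ _ ha hb
    have hle : adjoin ℚ (({(Real.pi : ℂ)} : Set ℂ) ∪ {((Real.log 2 : ℝ) : ℂ)}) ≤
        adjoin ℚ (Set.range l) := by
      rw [adjoin_le_iff]
      rintro a (ha | ha)
      · rw [Set.mem_singleton_iff.mp ha]; exact hpi_mem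
      · rw [Set.mem_singleton_iff.mp ha]; exact hlog_mem
    have htwo : ((2 : ℕ) : Cardinal) = (1 : Cardinal) + 1 := by norm_num
    rw [htwo]
    exact h2.trans (CalibrationA.trdeg_mono hle)

/-- **(R) implies the route statement `ToricPeriods.PiLogTwoAlgIndep`** (which is
`AlgebraicIndependent ℚ ![Real.pi, Real.log 2]` by definition; printed open, Roy 1992 p. 22,
Waldschmidt 2000 §1.4). -/
theorem piLogTwoAlgIndep_of_schanuelOnLogFreeCore
    (hR : Summit.Schanuel.Schanuel.Theses.RigidCore.SchanuelOnLogFreeCore) :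
    Summit.Schanuel.Schanuel.Theses.ToricPeriods.PiLogTwoAlgIndep :=
  piLogTwo_of_schanuelOnLogFreeCore hR

end CalibrationR

/-! ## The registered stub -/

/-- **Registered stub `stub_calibR_piLogTwo` of line `generic-period-fibre`** (signature verbatim):
the crux (R) — Schanuel's statement for `ℚ`-linearly independent tuples from the log-free core
`C_EA = sInf {K ≤ ℂ | 2πi ∈ K, K exp-closed, K relatively algebraically closed}` — implies the
algebraic independence of `π` and `log 2` (printed OPEN: Roy 1992 p. 22, Waldschmidt 2000 §1.4;
the route statement `ToricPeriods.PiLogTwoAlgIndep`).  This calibrates (R) against the Baker side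
(its rank-2 instance at `(πi, log 2)`, resp. the transcendence of `log 2` over `C_EA`, is already
`π ⊥ log 2`); it closes nothing.  Proof: `CalibrationR.piLogTwo_of_schanuelOnLogFreeCore`. -/
theorem stub_calibR_piLogTwo :
    Summit.Schanuel.Schanuel.Theses.RigidCore.SchanuelOnLogFreeCore →
      AlgebraicIndependent ℚ ![Real.pi, Real.log 2] :=
  fun hR => CalibrationR.piLogTwo_of_schanuelOnLogFreeCore hR

end Summit.Schanuel.Schanuel.Theorems.RigidCore

end
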